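import Literature.MathematicalPhysics.QuantumFieldTheory.Balaban1983to89.B2Eq37RemainingIntegralTower
import Literature.MathematicalPhysics.QuantumFieldTheory.Balaban1983to89.B2Eq2108HkOperator
import Literature.MathematicalPhysics.QuantumFieldTheory.Balaban1983to89.B2Ineq2109HiggsLatticeTower

/-!
# `Balaban1983to89.B2Eq37HkOfRecord` — T. Bałaban, *(Higgs)₂,₃ quantum fields in a finite volume. II. An upper bound*,
Commun. Math. Phys. **86** (1982) 555–594 [Balaban1982Higgs2] pp. 580, 583–586: **the remaining integral (3.7) on the tower of
record WITH THE `H_k` OF RECORD** — p23 g26's tower datum `B2Eq37RemainingIntegralTower.TowerInput37.toData37` with its last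
free operator slot `Data37.Hk` filled by p23 g15's `H_k` of (2.108) (`B2Ineq2109HiggsLattice.Inst.Hk`, for which (2.109)/(3.8)
and (3.12) are PROVED) through p23 g26's operator dictionary `B2Eq2108HkOperator.HkOp` — and three printed sentences for it,
kernel-checked for Bałaban's runs: (i) p. 584 *"we have applied formula (2.108) together with the remark following it to the
expression in the exponent in (3.5)"*: (3.7)'s lines 4–5 ARE minus one half of (2.108)'s three localized forms, i.e. (3.5)'s
three scalar operator lines (`lines45_eq_lines35`); (ii) p. 586 *"The property (3.8) implies … estimates for the norms … in L²"*
feeding the quadratic form: `⟨x̂′, H_kx̂′⟩ ≤ ‖H_k‖·‖x̂′‖²` for the fields inside `Λ₅⁽ᵏ⁾` (`hForm_le_opNorm`, `quad37_ge_opNorm`);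
(iii) p. 585 *"It is sufficient to get very weak estimates because we have the strong estimates (3.8), (3.10)"*, p. 586
*"Hence for Lᵏε sufficiently small, the operators G′_k − H′_k and G″_k − H″_k are positive and satisfy the inequalities (3.11)
with ½γ₁ instead of γ₁"* — for (3.7)'s OWN quadratic form `quad37` with the printed radii `r(Lᵏε)` and `Lᵏε ≤ ℓ₀`:
**`quad37_pos_printed`**

statement-level skeleton of published theorems with citation tags; proofs where landed; nothing here is a claim about the Yang–Mills mass gap

PDF held: `paper:balaban1982-cmp86-higgs23-ii` (journal page = PDF page + 554); pp. 580, 583–586 [PDF 26, 29–32] as read for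
`B2Ineq2109HiggsLattice` (p23 g15), `B2Eq37RemainingIntegral` (p23 g25), `B2Ineq312OperatorNorm` (r02 g7); p. 586 [PDF 32] re-read
as image here (render `…/1982-cmp86-higgs23-II-p032-x2.png` of the b2b reference pages) for the (3.12) sentence quoted below.

VERSIONS.  v1.0 = p391875 (p23 gen 26).  v1.1 (p23 gen 28, DOC-ONLY): the citation locator in the docstring of the field
`TowerInput37H.dA` corrected, «(2.98) p.576» → «(2.98) p.577» — (2.98) *"|(∂^{L^{−j}}_μ B̃)(x)| ≦ O(1)p(Lʲε)"* is the first numbered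
display of p. 577 [PDF 23] (render `…/1982-cmp86-higgs23-II-p023-x2.png` re-read as image; text layer `p0023.txt` l. 1–7), while
(2.94)–(2.97) close p. 576 — row P100-001 of the b2b-balaban summit-lit1 CITELOC register #28 (HOME/INBOX 2026-08-25T05:58:52Z);
nothing else changed (no declaration, statement or proof touched).

CITATION HEADER (lean-in-tree rule).  lit-balaban typed skeleton (HOME `run/shared/lean/pub/lit-balaban/`), Phase-2 proof
seat **p23** gen 26 (unit `lit-balaban-p23-g26`; TAKING #2 line HOME/STATUS.md).  SKELETON rows **B2.Eq3.1-3.10** ((3.5)/(3.7),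
owner r02, second reader r14), **B2.Eq2.109** ((2.108)/(2.109)), **B2.Eq3.11** ((3.11)/(3.12)) — CELLS ONLY, no head change
claimed.  USED BY NAME, NOTHING RESTATED: p23 g26 `B2Eq37RemainingIntegralTower.{TowerInput37, TowerInput37.toData37,
Λ5_subset_R6p}`, `B2Eq37QuadraticForm.{quad37, quad37_ge, quad37_ge_of_hForm_le}`, `B2Eq2108HkOperator.{HkOp, crdL6,
siteInner_cutTo_HkOp_cutTo, eq2108_siteInner_half, sum_prod_eq_sum_sub}`, the typer's `B2Eq246ScalarStep.fieldCoord_cutTo_apply`; p23 g25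
`B2Eq37RemainingIntegral.{Data37, Data37.dScal37, Data37.hForm37}`; p23 g15 `B2Ineq2109HiggsLattice.Inst.{Hk, L6, Ω, Ω₁, Ω₂}`,
`B2Ineq2109HiggsLatticeTower.{TowerData, TowerData.toInst, TowerData.Reg, TowerIdx, norm_Hk_le_tower, printedRad}` ((2.109),
(3.12) for the tower); r02 g7 `B2Ineq312OperatorNorm.abs_quadForm_le_l2_opNorm`; r14 `B2StepK.rDecayBeatsPowers_of_printed`
((2.109)₂ mechanism), `B2.Params.Printed`, `B2.rFn`; p35 `B1Eq230FluctCov.{deltaKA, siteInner_eq_dotProduct}`; p23 g10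
`B2Eq32FieldRegularity.field34`; typer `HiggsLattice.siteInner`, `B2Eq255Concrete.cutTo`, `HiggsCondGauss228.{fieldOfCrd,
cutTo_fieldOfCrd, inSet}`, `B4Sect5Proof.latticeConst`.

THE SOURCE TEXT (verbatim; displays in the files named).  p. 584: *"Also we have applied formula (2.108) together with the remark
following it to the expression in the exponent in (3.5). According to the remark, the matrix elements h_k(x, x′) of the operator
H_k satisfy the estimates"* (3.8).  p. 583 (3.5), innermost exponential (scalar part): *"− ½⟨(Λ₆^{(k−1)′}∩Λ₃^{(k)c})φ_k,
Δ^{(k),Lᵏε}(Bᵏ(Λ₂^{(k−1)′}∩Λ₅^{(k)c}), Ã^{(k),ε})(Λ₆^{(k−1)′}∩Λ₃^{(k)c})φ_k⟩ − ⟨(Λ₆^{(k−1)′}∩Λ₃^{(k)c})φ_k, Δ^{(k),Lᵏε}(Bᵏ(Λ₂^{(k−1)′}∩Λ₅^{(k)c}),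
Ã^{(k),ε})(Λ₃^{(k)}∩Λ₄^{(k)c})φ_k⟩ − ½⟨Λ₃^{(k)}φ_k, Δ^{(k),Lᵏε}(Bᵏ(Λ₂^{(k)}), Ã^{(k+1),ε})Λ₃^{(k)}φ_k⟩"*; p. 584 (3.7), lines 4–5:
*"− ½⟨Λ₆^{(k−1)′}φ_k, Δ⁽ᵏ⁾(Bᵏ(Λ₂^{(k−1)′}), Ã⁽ᵏ⁾)Λ₆^{(k−1)′}φ_k⟩ + ½⟨Λ₆^{(k−1)′}φ_k, H_kΛ₆^{(k−1)′}φ_k⟩"*.  p. 585/586: *"It is sufficient to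
get very weak estimates because we have the strong estimates (3.8), (3.10). … The property (3.8) implies in turn the following
estimates for the norms of H′_k, H″_k in L²(Λ₅⁽ᵏ⁾): ‖H′_k‖, ‖H″_k‖ ≦ O(1)exp(−δ₁r(Lᵏε)) ≦ O(1)(Lᵏε)^κ (3.12) for every κ.  Hence for
Lᵏε sufficiently small, the operators G′_k − H′_k and G″_k − H″_k are positive and satisfy the inequalities (3.11) with ½γ₁ instead
of γ₁."* (p. 586 [PDF 32] re-read as image for this version, render `…/1982-cmp86-higgs23-II-p032-x2.png`; second reader r14 v65
note N-r14-g24-1 — the earlier staged text p372471 misquoted this sentence as "for ε ≦ ε₁"; print's smallness is in `Lᵏε`, which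
is what `quad37_pos_printed` states: `P.mesh (j+1) ≤ ℓ₀`).

WHAT IS PROVED (kernel-checked, 0 `sorry`, standard axioms; DEFINITIONS WITH BODY (`TowerInput37H`, `toTowerData`, `inst`,
`toInput37`, `data`) + theorems; NO `Prop`-valued fact).
 §1 for ANY g15 instance `i`: `siteInner_HkOp_of_supported`, `siteInner_self_of_supported` (fields supported in `Λ₆′` in g15's
    coordinates), **`hForm_le_opNorm`** (`⟨f, H_kf⟩ ≤ ‖H_k‖·‖f‖²`, `‖·‖` = the `ℓ²(X)` operator norm of g15's matrix; r02 g7's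
    `abs_quadForm_le_l2_opNorm`).
 §2 `TowerInput37H` ↦ `toTowerData` (g15's tower step with `B̃ := Ã⁽ᵏ⁾ = field34 θ A k K`), `inst`, `toInput37` (p23 g26's input with
    `Hk := HkOp inst`), `data`; dictionary `inst_j`, `data_R6p/_Ω/_Atk/_Hk/_Λ5` (rfl: the two constructions name THE SAME sets `Λ₆′`,
    `Bᵏ(Λ₂′)`, field and region).
 §3 **`lines45_eq_lines35`**: `dScal37 + hForm37` at `φ_k` = `−½⟨Pφ, Δ⁽ᵏ⁾(Ω₁,Ã⁽ᵏ⁾)Pφ⟩ − ⟨Pφ, Δ⁽ᵏ⁾(Ω₁,Ã⁽ᵏ⁾)(Λ₃∖Λ₄)φ⟩ − ½⟨Λ₃φ, Δ⁽ᵏ⁾(Ω₂,Ã⁽ᵏ⁾)Λ₃φ⟩`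
    (`P = Λ₆′∖Λ₃`, `Ω₁ = Bᵏ(Λ₂′∖Λ₅⁽ᵏ⁾)`, `Ω₂ = Bᵏ(Λ₂⁽ᵏ⁾)`), by `eq2108_siteInner_half`.
 §4 `cutTo_eq_self_of_subset`, `cutTo_L6_fieldOfCrd`, `hForm_le_opNorm_data`, **`quad37_ge_opNorm`**: `γ(μ₀²)μ₀²‖x̂‖² + (γ(m²)m² − ‖H_k‖)‖x̂′‖² ≤ quad37(x̂, x̂′)` for the interior fields of (3.7) (F25 `quad37_ge` +
    §1), `γ(m) = a_∞/(a_∞ + m)`, `a_∞ = a(1 − L⁻²)`.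
 §5 **`quad37_pos_printed`**: for every `d`, `L > 1`, `a > 0`, `N`, printed ranges `Q` ((2.7): `R > 0`, `r > 1`), `m², μ₀² > 0` there is
    `ℓ₀ > 0` such that for EVERY torus of the model with these `d, L`, every tower input with `m²`, field `Ã⁽ᵏ⁾` regular on `Bᵏ(Λ₂′)`
    (g15's `TowerData.Reg`), the printed radii `rad = r(L^·ε)` and `Lᵏε ≤ ℓ₀`:
    `γ(μ₀²)μ₀²‖x̂‖² + ½γ(m²)m²‖x̂′‖² ≤ quad37(x̂, x̂′)` — from g15's `norm_Hk_le_tower` ((3.8) ⇒ (3.12): `‖H_k‖ ≤ C(Lᵏε)⁻²·N′K_d·e^{−δ₁r}`),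
    r14's `rDecayBeatsPowers_of_printed` (`e^{−δ₁r(ℓ)} ≤ C₃ℓ³`) and F25's `quad37_ge_of_hForm_le`; §6 `trivialInputH`, `exists_towerInput37H`.
HONEST SCOPE.  (a) The positivity is for (3.7)'s OWN quadratic form (`quad37`: the unconditioned `Δ⁽ᵏ⁾`-blocks and `H_k`), the
literal analogue of the p. 586 sentence which print states for (3.9)'s `G′_k − H′_k`, `G″_k − H″_k` (that sentence itself is r02
g7's `B2Ineq312OperatorNorm.sentence586_lattice` in matrix currency); the (2.49)/(2.46) passage from (3.7) to (3.9) is NOT claimed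
(F24/F25 HONEST SCOPE).  (b) The regularity of `Ã⁽ᵏ⁾` on `Bᵏ(Λ₂^{(k−1)′})` and the coupling smallness are g15's hypothesis
`TowerData.Reg` (print derives them in (2.94)–(2.98)/(3.2)–(3.4), p23 g10 `field32_regular_tower`), not re-derived; the printed
radii enter as the hypothesis `rad = printedRad Q`.  (c) ONE field `Ã⁽ᵏ⁾` in all operator slots of (2.108), as in g15 (the
`Ã^{(k+1)}` of (3.5)'s `Λ₃`-line agrees with it on `Bᵏ(Λ₂⁽ᵏ⁾)` where `θ_{k+1} = 1`; reading, not re-derived).  (d) `ℓ₀` depends on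
`(d, L, a, N, Q, m²)` only (chosen before the torus, the step, the regions and the fields); the constant `½γ(m²)` is print's
*"½γ₁ instead of γ₁"* with r02 g7's uniform `γ₁`.  (e) Vector species: no `H`-term (print's `H′_k` arises only in the (3.9)
passage), so its bound is F25's mass term unchanged.  Value = the last datum of (3.7) instantiated by the object of record and the
pp. 584–586 mechanism ((2.108) → (3.8) → (3.12) → positivity) assembled by name for Bałaban's runs; NOT summit progress.
-/

noncomputable section

open scoped BigOperators InnerProductSpace Matrix
open MeasureTheory

namespace Literature.MathematicalPhysics.QuantumFieldTheory.Balaban1983to89.B2Eq37HkOfRecord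

open HiggsLattice HiggsAveraging HiggsCovariance HiggsCovariancePos HiggsFluctMeasurePos B1Eq221Coordinates B1Eq27StepAdjoint
  B1Eq230FluctCov HiggsCondCov232 HiggsCondGauss228 B2Eq255Concrete B2Eq227CondDelta B2Eq39ConcreteForms B2Eq37RemainingIntegral
  B2Eq37QuadraticForm B2Eq37RemainingIntegralTower B2Eq32FieldRegularity B2Ineq2109HiggsLattice B2Ineq2109HiggsLatticeTower
  B2Eq2108HkOperator
open B2Eq228Conditioning (In Out resIn resOut glue)
open B3MultiscaleFields (zeroCharge)
open B2Eq324NestedRegions (prime Tower)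
open B2Eq243RegionsTower (towerRegion towerOf)
open B2Eq246ScalarStep (fieldCoord_cutTo_apply)
open Matrix

variable {P : HiggsLattice.Params} {N : ℕ}

/-! ## §1 The `H_k`-form of fields supported in `Λ₆^{(k−1)′}`, in operator-norm currency -/

section Supported

variable (i : Inst P N) (a : ℝ)

/-- For a field supported in `Λ₆′`: `⟨f, H_kf⟩ = (Lᵏε)ᵈ·(f̂|_X ⬝ᵥ (Hk *ᵥ f̂|_X))`. [cite: Balaban1982Higgs2, (2.108) p.580, (3.7) p.584] -/
theorem siteInner_HkOp_of_supported {f : ScalarField P (i.j + 1) N} (hf : cutTo i.L6 f = f) :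
    siteInner f (HkOp i a f) = P.mesh (i.j + 1) ^ P.d * (crdL6 i f ⬝ᵥ (i.Hk a *ᵥ crdL6 i f)) := by
  have h := siteInner_cutTo_HkOp_cutTo i a f
  rwa [hf] at h

/-- For a field supported in `Λ₆′`: `‖f‖² = (Lᵏε)ᵈ·(f̂|_X ⬝ᵥ f̂|_X)` ((I.1.5) in g15's coordinates). [cite: Balaban1982Higgs1, (1.5) p.604] -/
theorem siteInner_self_of_supported {f : ScalarField P (i.j + 1) N} (hf : cutTo i.L6 f = f) :
    siteInner f f = P.mesh (i.j + 1) ^ P.d * (crdL6 i f ⬝ᵥ crdL6 i f) := by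
  classical
  rw [siteInner_eq_dotProduct]
  congr 1
  simp only [dotProduct, crdL6_apply]
  refine sum_prod_eq_sum_sub i.L6 _ (fun p hp => ?_)
  have h0 : fieldCoord (E N) (HiggsLattice.Site P (i.j + 1)) f p = 0 := by
    rw [← hf, fieldCoord_cutTo_apply, if_neg hp]
  rw [h0, mul_zero]

open scoped Matrix.Norms.L2Operator in
/-- **`⟨f, H_kf⟩ ≤ ‖H_k‖·‖f‖²` for fields supported in `Λ₆^{(k−1)′}`** (`‖H_k‖` = the `ℓ²(X)` operator norm of g15's matrix, the
quantity (3.12) bounds; r02 g7's `abs_quadForm_le_l2_opNorm`). [cite: Balaban1982Higgs2, (3.12) p.586, (2.108) p.580] -/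
theorem hForm_le_opNorm {f : ScalarField P (i.j + 1) N} (hf : cutTo i.L6 f = f) :
    siteInner f (HkOp i a f) ≤ ‖i.Hk a‖ * siteInner f f := by
  rw [siteInner_HkOp_of_supported i a hf, siteInner_self_of_supported i hf]
  have h1 := B2Ineq312OperatorNorm.abs_quadForm_le_l2_opNorm (i.Hk a) (crdL6 i f)
  have h2 := le_abs_self (crdL6 i f ⬝ᵥ (i.Hk a *ᵥ crdL6 i f))
  have hm : 0 ≤ P.mesh (i.j + 1) ^ P.d := pow_nonneg (P.mesh_pos _).le _
  calc P.mesh (i.j + 1) ^ P.d * (crdL6 i f ⬝ᵥ (i.Hk a *ᵥ crdL6 i f))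
      ≤ P.mesh (i.j + 1) ^ P.d * (‖i.Hk a‖ * (crdL6 i f ⬝ᵥ crdL6 i f)) :=
        mul_le_mul_of_nonneg_left (h2.trans h1) hm
    _ = ‖i.Hk a‖ * (P.mesh (i.j + 1) ^ P.d * (crdL6 i f ⬝ᵥ crdL6 i f)) := by ring

/-- A field supported in `Λ ⊆ R` is supported in `R`. [cite: Balaban1982Higgs2, (2.8) p.558] [folklore] -/
theorem cutTo_eq_self_of_subset {k N' : ℕ} {Λ R : Finset (HiggsLattice.Site P k)} (h : Λ ⊆ R) {f : ScalarField P k N'}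
    (hf : cutTo Λ f = f) : cutTo R f = f := by
  funext y
  by_cases hy : y ∈ R
  · rw [cutTo_of_mem R f hy]
  · have hyΛ : y ∉ Λ := fun h' => hy (h h')
    have h0 : f y = 0 := by rw [← hf, cutTo_of_not_mem Λ f hyΛ]
    rw [cutTo_of_not_mem R f hy, h0]

end Supported

/-! ## §2 The (3.7) input on the tower of record with the `H_k` of record -/

variable (P N) in
/-- **The inputs of (3.7) on Bałaban's tower, `H_k` slot excluded** (it is FILLED below by g15's `H_k`): p23 g26's `TowerInput37`
fields (steps `K`, level `k = j + 1`, large-field points and radii of every step, cut-offs `θ_l` and minimizers `A^{(l),ε}` of (3.4),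
the fields and weights of `Data37`) plus the scalar charge data `C`, the mass `m² > 0` and the regularity modulus `δ_A` of g15's
tower step. [cite: Balaban1982Higgs2, (3.7) p.584, (2.108) p.580] -/
structure TowerInput37H where
  K : ℕ
  hK : K ≤ P.K
  j : ℕ
  hj : j + 1 ≤ K
  bad : (l : ℕ) → Set (HiggsLattice.Site P l)
  rad : ℕ → ℝ
  hrad : ∀ l, 0 ≤ rad l
  θ : ℕ → HiggsLattice.Site P 0 → ℝ
  Amin : ℕ → HiggsLattice.VecField P 0
  Ak : ScalarField P (j + 1) P.d
  φk : ScalarField P (j + 1) N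
  A : (n : ℕ) → ScalarField P (j + 1 + n) P.d
  φ : (n : ℕ) → ScalarField P (j + 1 + n) N
  chik : ScalarField P (j + 1) P.d → ScalarField P (j + 1) N → ℝ
  chi : (n : ℕ) → ScalarField P (j + 1 + n) P.d → ScalarField P (j + 1 + n) N → ℝ
  rhoP : ScalarField P (j + 1) P.d → HiggsLattice.VecField P 0 → ScalarField P (j + 1) N → ℝ
  /-- the scalar charge data of (1.1). [cite: Balaban1982Higgs2, (1.1) p.555] -/
  C : ChargeData N
  /-- `m²`. [cite: Balaban1982Higgs2, (1.1) p.555] -/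
  msq : ℝ
  hmsq : 0 < msq
  /-- the regularity modulus `δ_A` of `Ã⁽ᵏ⁾` on `Bᵏ(Λ₂^{(k−1)′})` ((2.98)/(I.2.23), g15's datum). [cite: Balaban1982Higgs2, (2.98) p.577] -/
  dA : ℝ

namespace TowerInput37H

variable (t : TowerInput37H P N) (a : ℝ)

/-- **g15's tower step for THIS input**: level `k = j + 1`, field `B̃ := Ã⁽ᵏ⁾ = field34 θ A k K` ((3.4); p. 584: the operator of
(3.7)'s line 4 carries `Ã⁽ᵏ⁾`), mass, modulus, the same large-field points and radii. [cite: Balaban1982Higgs2, (2.108) p.580, (3.4) p.583] -/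
def toTowerData : TowerData P N where
  j := t.j
  hjK := t.hj.trans t.hK
  C := t.C
  A := field34 t.θ t.Amin (t.j + 1) t.K
  msq := t.msq
  hmsq := t.hmsq
  dA := t.dA
  bad := t.bad
  rad := t.rad
  hrad0 := t.hrad t.j
  hrad1 := t.hrad (t.j + 1)

/-- g15's instance of (2.108) for this input (the sets `Λ₂^{(k−1)′} ⊇ Λ₆^{(k−1)′} ⊇ Λ₃⁽ᵏ⁾ ⊇ Λ₄⁽ᵏ⁾ ⊇ Λ₅⁽ᵏ⁾`, `Λ₂⁽ᵏ⁾` from the tower,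
`r = rad k`). [cite: Balaban1982Higgs2, (2.108) p.580] -/
abbrev inst : Inst P N := t.toTowerData.toInst

/-- **p23 g26's (3.7) input WITH THE `H_k` OF RECORD**: `Hk := HkOp inst` (g15's `H_k` as an operator, p23 g26
`B2Eq2108HkOperator`). [cite: Balaban1982Higgs2, (3.7) p.584, (2.108) p.580] -/
def toInput37 : TowerInput37 P N where
  K := t.K
  hK := t.hK
  j := t.j
  hj := t.hj
  bad := t.bad
  rad := t.rad
  hrad := t.hrad
  θ := t.θ
  Amin := t.Amin
  Ak := t.Ak
  φk := t.φk
  A := t.A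
  φ := t.φ
  chik := t.chik
  chi := t.chi
  rhoP := t.rhoP
  Hk := HkOp t.inst a

/-- **THE (3.7) DATUM OF RECORD** (geometry, masks, Neumann region, (3.4) fields from p23 g26's `toData37`; `H_k` of record).
[cite: Balaban1982Higgs2, (3.7) p.584] -/
abbrev data : Data37 P N := (t.toInput37 a).toData37

/-- The level of g15's instance is `j` (definitional). [cite: Balaban1982Higgs2, (2.108) p.580] -/
theorem inst_j : t.inst.j = t.j := rfl

/-- `Λ₆^{(k−1)′}` of the (3.7) datum IS g15's `L6` (both `(towerRegion bad rad j 6)′`; definitional). [cite: Balaban1982Higgs2, (3.7) p.584] -/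
theorem data_R6p : (t.data a).R6p = t.inst.L6 := rfl

/-- `Bᵏ(Λ₂^{(k−1)′})` of the (3.7) datum IS g15's `Ω` (definitional). [cite: Balaban1982Higgs2, (3.7) p.584, (2.108) p.580] -/
theorem data_Ω : (t.data a).Ω = t.inst.Ω := rfl

/-- `Ã⁽ᵏ⁾` of the (3.7) datum IS g15's field `B̃` (definitional). [cite: Balaban1982Higgs2, (3.4) p.583] -/
theorem data_Atk : (t.data a).Atk = t.inst.A := rfl

/-- `H_k` of the (3.7) datum IS g15's `H_k` as an operator (definitional). [cite: Balaban1982Higgs2, (2.108) p.580] -/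
theorem data_Hk : (t.data a).Hk = HkOp t.inst a := rfl

/-- `Λ₅⁽ᵏ⁾` of the (3.7) datum IS g15's `L5` (definitional). [cite: Balaban1982Higgs2, (2.8) p.558] -/
theorem data_Λ5 : (t.data a).G.Λ5 = (towerOf t.bad t.rad t.hrad t.K).lam (t.j + 1) := rfl

/-! ## §3 (3.7)'s lines 4–5 are (2.108) applied to (3.5)'s scalar operator lines -/

/-- **p. 584 *"we have applied formula (2.108) together with the remark following it to the expression in the exponent in
(3.5)"*, KERNEL-CHECKED FOR BAŁABAN'S RUNS**: for every field `φ_k` on `T⁽ᵏ⁾`, lines 4–5 of (3.7) with the `H_k` of record,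
`−½⟨Λ₆′φ_k, Δ⁽ᵏ⁾(Bᵏ(Λ₂′), Ã⁽ᵏ⁾)Λ₆′φ_k⟩ + ½⟨Λ₆′φ_k, H_kΛ₆′φ_k⟩`, EQUAL (3.5)'s three scalar operator lines
`−½⟨Pφ_k, Δ⁽ᵏ⁾(Ω₁, Ã⁽ᵏ⁾)Pφ_k⟩ − ⟨Pφ_k, Δ⁽ᵏ⁾(Ω₁, Ã⁽ᵏ⁾)(Λ₃∖Λ₄)φ_k⟩ − ½⟨Λ₃φ_k, Δ⁽ᵏ⁾(Ω₂, Ã⁽ᵏ⁾)Λ₃φ_k⟩`, `P = Λ₆^{(k−1)′}∖Λ₃⁽ᵏ⁾`,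
`Ω₁ = Bᵏ(Λ₂^{(k−1)′}∖Λ₅⁽ᵏ⁾)`, `Ω₂ = Bᵏ(Λ₂⁽ᵏ⁾)` (p23 g26 `eq2108_siteInner_half`). [cite: Balaban1982Higgs2, (3.7) p.584, (3.5) p.583, (2.108) p.580] -/
theorem lines45_eq_lines35 (φ : ScalarField P (t.j + 1) N) :
    (t.data a).dScal37 t.C t.msq a φ + (t.data a).hForm37 φ
      = -(1 / 2 : ℝ) * siteInner (cutTo (t.inst.L6 \ t.inst.L3) φ)
            (deltaKA t.C t.inst.Ω₁ t.inst.A t.msq a (t.j + 1) (cutTo (t.inst.L6 \ t.inst.L3) φ))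
        - siteInner (cutTo (t.inst.L6 \ t.inst.L3) φ)
            (deltaKA t.C t.inst.Ω₁ t.inst.A t.msq a (t.j + 1) (cutTo (t.inst.L3 \ t.inst.L4) φ))
        - (1 / 2 : ℝ) * siteInner (cutTo t.inst.L3 φ) (deltaKA t.C t.inst.Ω₂ t.inst.A t.msq a (t.j + 1) (cutTo t.inst.L3 φ)) :=
  eq2108_siteInner_half t.inst a φ

/-! ## §4 The quadratic form of (3.7) with the `H_k` of record: operator-norm currency -/

/-- The interior scalar field of (3.7) is supported in `Λ₆^{(k−1)′}` (`Λ₅⁽ᵏ⁾ ⊆ Λ₆^{(k−1)′}`, p23 g26 `Λ5_subset_R6p`).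
[cite: Balaban1982Higgs2, (2.8) p.558, (3.7) p.584] -/
theorem cutTo_L6_fieldOfCrd (x' : In (inSet (P := P) N (t.data a).G.Λ5) → ℝ) :
    cutTo t.inst.L6 (fieldOfCrd (t.data a).G.Λ5 x') = fieldOfCrd (t.data a).G.Λ5 x' :=
  cutTo_eq_self_of_subset (t.toInput37 a).Λ5_subset_R6p (cutTo_fieldOfCrd _ x')

open scoped Matrix.Norms.L2Operator in
/-- **The `H_k`-form of the interior field is bounded by `‖H_k‖`**: `⟨x̂′, H_kx̂′⟩ ≤ ‖H_k‖·‖x̂′‖²` for every `x̂′ = φ_k↾Λ₅⁽ᵏ⁾`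
extended by zero — F25's hypothesis `hH` in the currency (3.12) bounds. [cite: Balaban1982Higgs2, (3.12) p.586, (3.7) p.584] -/
theorem hForm_le_opNorm_data {xh' : ScalarField P (t.j + 1) N} (h : cutTo (t.data a).G.Λ5 xh' = xh') :
    siteInner xh' ((t.data a).Hk xh') ≤ ‖t.inst.Hk a‖ * siteInner xh' xh' :=
  hForm_le_opNorm t.inst a (cutTo_eq_self_of_subset (t.toInput37 a).Λ5_subset_R6p h)

open scoped Matrix.Norms.L2Operator in
/-- **`quad37 ≥ γ(μ₀²)μ₀²‖x̂‖² + (γ(m²)m² − ‖H_k‖)‖x̂′‖²`** for the (3.7) datum of record (F25 `quad37_ge` + `hForm_le_opNorm`; m²,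
μ₀² > 0, a > 0, L > 1, `Lᵏε ≤ 1`). [cite: Balaban1982Higgs2, (3.11) p.585, (3.12) p.586, (3.7) p.584] -/
theorem quad37_ge_opNorm {μ : ℝ} (hμ : 0 < μ) (ha : 0 < a) (hL : 1 < (P.L : ℝ)) (hs : P.mesh (t.j + 1) ≤ 1)
    (xh : ScalarField P (t.j + 1) P.d) {xh' : ScalarField P (t.j + 1) N} (h : cutTo (t.data a).G.Λ5 xh' = xh') :
    a * (1 - ((P.L : ℝ) ^ 2)⁻¹) / (a * (1 - ((P.L : ℝ) ^ 2)⁻¹) + μ) * μ * siteInner xh xh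
        + (a * (1 - ((P.L : ℝ) ^ 2)⁻¹) / (a * (1 - ((P.L : ℝ) ^ 2)⁻¹) + t.msq) * t.msq - ‖t.inst.Hk a‖) * siteInner xh' xh'
      ≤ quad37 t.C μ t.msq a (t.data a) xh xh' := by
  have h1 := quad37_ge t.C μ t.msq a (t.data a) hμ t.hmsq ha hL hs xh xh'
  have h2 := t.hForm_le_opNorm_data a h
  calc a * (1 - ((P.L : ℝ) ^ 2)⁻¹) / (a * (1 - ((P.L : ℝ) ^ 2)⁻¹) + μ) * μ * siteInner xh xh
        + (a * (1 - ((P.L : ℝ) ^ 2)⁻¹) / (a * (1 - ((P.L : ℝ) ^ 2)⁻¹) + t.msq) * t.msq - ‖t.inst.Hk a‖) * siteInner xh' xh'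
      ≤ a * (1 - ((P.L : ℝ) ^ 2)⁻¹) / (a * (1 - ((P.L : ℝ) ^ 2)⁻¹) + μ) * μ * siteInner xh xh
        + a * (1 - ((P.L : ℝ) ^ 2)⁻¹) / (a * (1 - ((P.L : ℝ) ^ 2)⁻¹) + t.msq) * t.msq * siteInner xh' xh'
        - siteInner xh' ((t.data a).Hk xh') := by
          rw [sub_mul]
          linarith
    _ ≤ quad37 t.C μ t.msq a (t.data a) xh xh' := h1

/-! ## §5 Positivity for the printed radii and small `Lᵏε` -/

open scoped Matrix.Norms.L2Operator in
/-- **POSITIVITY OF (3.7)'s QUADRATIC FORM FOR BAŁABAN'S RUNS** (p. 585: *"It is sufficient to get very weak estimates because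
we have the strong estimates (3.8), (3.10)"*; p. 586: *"‖H′_k‖, ‖H″_k‖ ≦ O(1)exp(−δ₁r(Lᵏε)) ≦ O(1)(Lᵏε)^κ (3.12) for every κ.  Hence
for Lᵏε sufficiently small, the operators G′_k − H′_k and G″_k − H″_k are positive and satisfy the inequalities (3.11) with ½γ₁
instead of γ₁"*, here for (3.7)'s own form): for every `d`, `L > 1`, `a > 0`,
`N`, printed ranges `Q`, `m², μ₀² > 0` there is `ℓ₀ > 0` such that on EVERY torus of the model with these `d, L`, for every tower
input with mass `m²`, field `Ã⁽ᵏ⁾` regular on `Bᵏ(Λ₂^{(k−1)′})` (g15's `Reg`), the printed radii `rad = r(L^·ε)` and `Lᵏε ≤ ℓ₀`, and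
all interior fields `x̂ = A_k↾Λ₅`, `x̂′ = φ_k↾Λ₅`: `γ(μ₀²)μ₀²‖x̂‖² + ½γ(m²)m²‖x̂′‖² ≤ quad37(x̂, x̂′)`.
[cite: Balaban1982Higgs2, (3.11) p.585, (3.12) p.586, (3.8) p.584, (3.7) p.584] -/
theorem quad37_pos_printed (d L : ℕ) (hL : 1 < L) {a : ℝ} (ha : 0 < a) (N : ℕ) (Q : B2.Params) (hQ : Q.Printed)
    {msq μ : ℝ} (hmsq : 0 < msq) (hμ : 0 < μ) :
    ∃ ℓ₀ : ℝ, 0 < ℓ₀ ∧ ∀ {P : HiggsLattice.Params}, P.d = d → P.L = L → ∀ (t : TowerInput37H P N), t.msq = msq →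
      TowerData.Reg a t.toTowerData → t.rad = printedRad Q P → P.mesh (t.j + 1) ≤ ℓ₀ →
      ∀ (x : In (inSet (P := P) P.d (t.data a).G.Λ5) → ℝ) (x' : In (inSet (P := P) N (t.data a).G.Λ5) → ℝ),
        a * (1 - ((L : ℝ) ^ 2)⁻¹) / (a * (1 - ((L : ℝ) ^ 2)⁻¹) + μ) * μ
            * siteInner (fieldOfCrd (t.data a).G.Λ5 x) (fieldOfCrd (t.data a).G.Λ5 x)
          + (1 / 2 : ℝ) * (a * (1 - ((L : ℝ) ^ 2)⁻¹) / (a * (1 - ((L : ℝ) ^ 2)⁻¹) + msq) * msq)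
            * siteInner (fieldOfCrd (t.data a).G.Λ5 x') (fieldOfCrd (t.data a).G.Λ5 x')
          ≤ quad37 t.C μ t.msq a (t.data a) (fieldOfCrd (t.data a).G.Λ5 x) (fieldOfCrd (t.data a).G.Λ5 x') := by
  -- (3.8) ⇒ (3.12) for the tower (g15): one `(C, δ₀, δ₁)` per `(d, L, a)`
  obtain ⟨C, δ₀, δ₁, hC, hδ₀, hδ₁, hnorm⟩ := norm_Hk_le_tower d L hL ha
  -- (2.109)₂ mechanism (r14): `e^{−δ₁r(ℓ)} ≤ C₃ℓ³` on `(0, 1]`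
  obtain ⟨C₃, hC₃⟩ := B2StepK.rDecayBeatsPowers_of_printed Q hQ hδ₁ (3 : ℝ)
  have hLr : 1 < (L : ℝ) := by exact_mod_cast hL
  set γm : ℝ := a * (1 - ((L : ℝ) ^ 2)⁻¹) / (a * (1 - ((L : ℝ) ^ 2)⁻¹) + msq) * msq with hγm
  have hγm0 : 0 < γm := by
    have hL2 : 1 < (L : ℝ) ^ 2 := by nlinarith
    have hinv : ((L : ℝ) ^ 2)⁻¹ < 1 := inv_lt_one_of_one_lt₀ hL2
    have hX : 0 < a * (1 - ((L : ℝ) ^ 2)⁻¹) := mul_pos ha (by linarith)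
    exact mul_pos (div_pos hX (by linarith)) hmsq
  set K₀ : ℝ := C * ((Module.finrank ℝ (E N) : ℝ) * B4Sect5Proof.latticeConst d δ₀) with hK₀
  have hK₀0 : 0 ≤ K₀ := mul_nonneg hC.le (mul_nonneg (Nat.cast_nonneg _) (B4Sect5Proof.latticeConst_nonneg d hδ₀.le))
  set B : ℝ := max (K₀ * C₃) 1 with hB
  have hB1 : 1 ≤ B := le_max_right _ _
  have hB0 : 0 < B := lt_of_lt_of_le one_pos hB1
  refine ⟨min 1 (γm / (4 * B)), lt_min one_pos (div_pos hγm0 (mul_pos (by norm_num) hB0)), ?_⟩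
  intro P hPd hPL t htm hreg hrad hs x x'
  have hs1 : P.mesh (t.j + 1) ≤ 1 := hs.trans (min_le_left _ _)
  have hsB : P.mesh (t.j + 1) ≤ γm / (4 * B) := hs.trans (min_le_right _ _)
  have hspos : 0 < P.mesh (t.j + 1) := P.mesh_pos _
  have hPL' : (P.L : ℝ) = L := by exact_mod_cast hPL
  have hLP : 1 < (P.L : ℝ) := by rw [hPL']; exact hLr
  -- the operator norm of `H_k` for this step
  let ι : TowerIdx d L a := ⟨P, hPd, hPL, N, t.toTowerData, hreg⟩
  have hn := hnorm ι
  have hrad' : t.rad (t.j + 1) = B2.rFn Q.R Q.r (P.mesh (t.j + 1)) := by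
    rw [hrad]; rfl
  have hexp : Real.exp (-(δ₁ * t.rad (t.j + 1))) ≤ C₃ * P.mesh (t.j + 1) ^ (3 : ℝ) := by
    rw [hrad']; exact hC₃ _ hspos hs1
  have hpow : P.mesh (t.j + 1) ^ (3 : ℝ) = P.mesh (t.j + 1) ^ (3 : ℕ) := by
    rw [show (3 : ℝ) = ((3 : ℕ) : ℝ) by norm_num, Real.rpow_natCast]
  have hHk : ‖t.inst.Hk a‖ ≤ B * P.mesh (t.j + 1) := by
    have h1 : ‖t.inst.Hk a‖ ≤ C * (P.mesh (t.j + 1))⁻¹ ^ 2 *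
        ((Module.finrank ℝ (E N) : ℝ) * B4Sect5Proof.latticeConst P.d δ₀) * Real.exp (-(δ₁ * t.rad (t.j + 1))) := hn
    rw [hPd] at h1
    have h2 : C * (P.mesh (t.j + 1))⁻¹ ^ 2 * ((Module.finrank ℝ (E N) : ℝ) * B4Sect5Proof.latticeConst d δ₀)
        * Real.exp (-(δ₁ * t.rad (t.j + 1)))
        ≤ C * (P.mesh (t.j + 1))⁻¹ ^ 2 * ((Module.finrank ℝ (E N) : ℝ) * B4Sect5Proof.latticeConst d δ₀)
          * (C₃ * P.mesh (t.j + 1) ^ (3 : ℕ)) := by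
      rw [← hpow]
      exact mul_le_mul_of_nonneg_left hexp
        (mul_nonneg (mul_nonneg hC.le (pow_nonneg (inv_nonneg.2 hspos.le) 2))
          (mul_nonneg (Nat.cast_nonneg _) (B4Sect5Proof.latticeConst_nonneg d hδ₀.le)))
    have h3 : C * (P.mesh (t.j + 1))⁻¹ ^ 2 * ((Module.finrank ℝ (E N) : ℝ) * B4Sect5Proof.latticeConst d δ₀)
          * (C₃ * P.mesh (t.j + 1) ^ (3 : ℕ)) = K₀ * C₃ * P.mesh (t.j + 1) := by
      rw [hK₀]
      field_simp
    have h4 : K₀ * C₃ * P.mesh (t.j + 1) ≤ B * P.mesh (t.j + 1) :=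
      mul_le_mul_of_nonneg_right (le_max_left _ _) hspos.le
    linarith
  -- hence `‖H_k‖ ≤ γm/4 ≤ ½γm`
  have hη : ‖t.inst.Hk a‖ ≤ (1 / 2 : ℝ) * γm := by
    have h1 : B * P.mesh (t.j + 1) ≤ B * (γm / (4 * B)) := mul_le_mul_of_nonneg_left hsB hB0.le
    have h2 : B * (γm / (4 * B)) = γm / 4 := by field_simp
    linarith
  -- F25's "very weak estimates suffice" with `η := ‖H_k‖`
  have hH : ∀ xh' : ScalarField P ((t.data a).G.j + 1) N, cutTo (t.data a).G.Λ5 xh' = xh' →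
      siteInner xh' ((t.data a).Hk xh') ≤ ‖t.inst.Hk a‖ * siteInner xh' xh' :=
    fun xh' h => t.hForm_le_opNorm_data a h
  have hγm' : (1 / 2 : ℝ) * γm
      = (1 / 2 : ℝ) * (a * (1 - ((P.L : ℝ) ^ 2)⁻¹) / (a * (1 - ((P.L : ℝ) ^ 2)⁻¹) + t.msq) * t.msq) := by
    rw [hγm, hPL', htm]
  have hmain := quad37_ge_of_hForm_le t.C μ t.msq a (t.data a) hμ t.hmsq ha hLP hs1 (η := ‖t.inst.Hk a‖)
    (by rw [← hγm']; exact hη) hH (fieldOfCrd (t.data a).G.Λ5 x) (cutTo_fieldOfCrd _ x')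
  rw [hPL'] at hmain
  rw [hγm, ← htm]
  exact hmain

end TowerInput37H

/-! ## §6 Non-vacuity -/

variable (P N) in
/-- The trivial input (no large field, zero radii, cut-offs, fields and modulus; unit weights; any charge data and mass).
[cite: Balaban1982Higgs2, (3.7) p.584] -/
def trivialInputH {K j : ℕ} (hK : K ≤ P.K) (hj : j + 1 ≤ K) (C : ChargeData N) {msq : ℝ} (hmsq : 0 < msq) :
    TowerInput37H P N where
  K := K
  hK := hK
  j := j
  hj := hj
  bad := fun _ => ∅
  rad := fun _ => 0
  hrad := fun _ => le_rfl
  θ := fun _ _ => 0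
  Amin := fun _ => 0
  Ak := 0
  φk := 0
  A := fun _ => 0
  φ := fun _ => 0
  chik := fun _ _ => 1
  chi := fun _ _ _ => 1
  rhoP := fun _ _ _ => 1
  C := C
  msq := msq
  hmsq := hmsq
  dA := 0

/-- The input type is inhabited at every admissible `(K, k)`, charge and mass. [cite: Balaban1982Higgs2, (3.7) p.584] -/
theorem exists_towerInput37H {K j : ℕ} (hK : K ≤ P.K) (hj : j + 1 ≤ K) (C : ChargeData N) {msq : ℝ} (hmsq : 0 < msq) :
    ∃ t : TowerInput37H P N, t.K = K ∧ t.j = j ∧ t.msq = msq :=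
  ⟨trivialInputH P N hK hj C hmsq, rfl, rfl, rfl⟩

end Literature.MathematicalPhysics.QuantumFieldTheory.Balaban1983to89.B2Eq37HkOfRecord

end
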